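import Mathlib
import Summits.Ventures.PercRepro2.M9WeightedHarris

/-!
# The linking cube is non-positive (blind cell PercRepro2, p3 g28, 2026-08-28;
`proofs/P3-PENDANT.md` §6, CLASS C6 in general)

CLASS C6 of the single-`d` statement: every linking block (rooted at both `r` and `s`) is not
joined to `d` and is attached to marks only, and `d` cannot link `r, s` by itself.  Then for a
fixed state of everything else, `σ_rs` is `[T ≠ ∅] − [T ≠ L]` for the set `T ⊆ L` of linking
blocks on the `Y` side, `σ_pq = g T` is antitone in `T` and the legality does not depend on
`T`; so the sum over the cube `2^L` is `≤ 0` (`linkCube_sum_nonpos`): `f T = [T ≠ ∅] − [T ≠ L]`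
is monotone and odd under `T ↦ L ∖ T`, and `M9WeightedHarris` with the constant weight
applies.  `|L| = 1` is the pairing of `M9PairingNonpos`.  No definitions.  Own work; std
axioms.
-/

namespace Summit.Ventures.PercRepro2

namespace M9Reduce

open Finset

variable {ι : Type*} [Fintype ι] [DecidableEq ι]

/-- `σ_rs` on the linking cube: `+1` when some linking block is `Y`-side and none is
`W`-side, `−1` symmetrically, `0` otherwise. -/
lemma linkSign_compl (T : Finset ι) :
    ((if (Tᶜ).Nonempty then (1 : ℤ) else 0) - (if Tᶜ ≠ univ then (1 : ℤ) else 0)) =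
      -((if T.Nonempty then (1 : ℤ) else 0) - (if T ≠ univ then (1 : ℤ) else 0)) := by
  have h1 : (Tᶜ).Nonempty ↔ T ≠ univ := by
    rw [Finset.nonempty_iff_ne_empty, Ne, Ne, Finset.compl_eq_empty_iff]
  have h2 : Tᶜ ≠ univ ↔ T.Nonempty := by
    rw [Finset.nonempty_iff_ne_empty, Ne, Ne, Finset.compl_eq_univ_iff]
  by_cases ha : T.Nonempty <;> by_cases hb : T ≠ univ
  · rw [if_pos (h1.2 hb), if_pos (h2.2 ha), if_pos ha, if_pos hb]; ring
  · rw [if_neg (fun h => hb (h1.1 h)), if_pos (h2.2 ha), if_pos ha, if_neg hb]; ring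
  · rw [if_pos (h1.2 hb), if_neg (fun h => ha (h2.1 h)), if_neg ha, if_pos hb]; ring
  · rw [if_neg (fun h => hb (h1.1 h)), if_neg (fun h => ha (h2.1 h)), if_neg ha, if_neg hb]; ring

/-- `σ_rs` on the linking cube is monotone. -/
lemma linkSign_mono :
    Monotone (fun T : Finset ι =>
      (if T.Nonempty then (1 : ℤ) else 0) - (if T ≠ univ then (1 : ℤ) else 0)) := by
  intro T T' hTT'
  have h1 : (if T.Nonempty then (1 : ℤ) else 0) ≤ (if T'.Nonempty then (1 : ℤ) else 0) := by
    by_cases h : T.Nonempty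
    · rw [if_pos h, if_pos (h.mono hTT')]
    · rw [if_neg h]; split_ifs <;> norm_num
  have h2 : (if T' ≠ univ then (1 : ℤ) else 0) ≤ (if T ≠ univ then (1 : ℤ) else 0) := by
    by_cases h : T' ≠ univ
    · have : T ≠ univ := fun hT => h (Finset.univ_subset_iff.1 (hT ▸ hTT'))
      rw [if_pos h, if_pos this]
    · rw [if_neg h]; split_ifs <;> norm_num
  linarith

/-- **The linking cube is non-positive**: for an antitone `g` on `2^L`,
`∑_T ([T ≠ ∅] − [T ≠ L]) · g T ≤ 0`. -/
theorem linkCube_sum_nonpos {g : Finset ι → ℤ} (hg : Antitone g) :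
    ∑ T : Finset ι, ((if T.Nonempty then (1 : ℤ) else 0) - (if T ≠ univ then (1 : ℤ) else 0)) *
      g T ≤ 0 := by
  have := sum_weight_mul_nonpos (α := Finset ι) (κ := fun T => Tᶜ) (fun T => compl_compl T)
    (μ := fun _ => (1 : ℤ)) (fun _ => by norm_num) (fun _ _ => by norm_num) (fun _ => rfl)
    linkSign_mono (fun T => linkSign_compl T) hg
  simpa using this

end M9Reduce

end Summit.Ventures.PercRepro2
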